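import Summits.AtomisticToContinuum.HydrodynamicLimit.Theorems.CollisionIsometryCLTMacroClosureThermoLimit
import Summits.AtomisticToContinuum.HydrodynamicLimit.Theorems.CollisionIsometryCLTMacroClosureRuelleConvexity
import Summits.AtomisticToContinuum.HydrodynamicLimit.Theorems.CollisionIsometryCLTMacroClosureStubClausiusLimits
import HarnessLib

/-!
# Uniform cell rate for the UNSHRUNK unit cube (input of `stub_blockMGF_twoScale`, line `IdeatorTwoGen1Sketch`,
crux `MacroClosure`, stmt-AtomisticToContinuum-14870)

Proof file (`--supports stmt-AtomisticToContinuum-14870`) for the registered stub `Barycentric.stub_cellRate`: from the landed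
`hs_boxRate_uniform` (Ruelle's SHRUNK inner cube `|w i l| ≤ (1 − e)/2`, `e = (η/m)^{1/3}`) by the affine change of variables
`w ↦ c + (1 − e')·w` with `e' = e/(1+e)` (so that the separation `e` in the unit cube becomes `e'` in the cube of side `1 − e'`,
i.e. packing `η' = m e'³ = η/(1+e)³`), the uniform continuity of `f_ex` on compacts of `(0, 11/10)`
(`Clausius.continuousOn_hsExcessFreeEnergy stub_hsFreeEnergyConvex`) and `(1 − e')^{−3m} ≤ e^{εm}` eventually.
-/

noncomputable section

open MeasureTheory Filter Set Topology InformationTheory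
open scoped ENNReal ContDiff Pointwise

namespace Summit.AtomisticToContinuum.HydrodynamicLimit.Theorems.MacroClosureLine

open Literature.MathematicalPhysics.KineticTheory Literature.Analysis.FluidPDE
open Literature.Analysis.FunctionSpaces


namespace Barycentric

namespace CellRate

/-! ### Geometry: translation to the centred cube and Lebesgue scaling -/

/-- The unit-cube cell set `{w | 0 ≤ w i l ≤ 1, pairwise e ≤ ‖w i − w j‖}` is the translate by the centre
`(1/2, 1/2, 1/2)` (in every factor) of the centred one `{w | |w i l| ≤ 1/2, pairwise e ≤ ‖w i − w j‖}`. -/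
theorem cell_eq_preimage (m : ℕ) (e : ℝ) :
    {w : Fin m → V3 | (∀ i l, 0 ≤ w i l ∧ w i l ≤ 1) ∧ ∀ i j, i ≠ j → e ≤ ‖w i - w j‖} =
      (fun w : Fin m → V3 => w + fun _ => -(WithLp.toLp 2 (fun _ : Fin 3 => (1 / 2 : ℝ)) : V3)) ⁻¹'
        {w : Fin m → V3 | (∀ i l, |w i l| ≤ 1 / 2) ∧ ∀ i j, i ≠ j → e ≤ ‖w i - w j‖} := by
  ext w
  simp only [Set.mem_preimage, Set.mem_setOf_eq, Pi.add_apply, PiLp.add_apply, PiLp.neg_apply,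
    add_sub_add_right_eq_sub, abs_le]
  refine and_congr (forall_congr' fun i => forall_congr' fun l => ?_) Iff.rfl
  constructor <;> rintro ⟨h1, h2⟩ <;> constructor <;> linarith

/-- Translation invariance: the unit-cube cell set and the centred cell set have the same volume. -/
theorem volume_cell_eq (m : ℕ) (e : ℝ) :
    volume {w : Fin m → V3 | (∀ i l, 0 ≤ w i l ∧ w i l ≤ 1) ∧ ∀ i j, i ≠ j → e ≤ ‖w i - w j‖} =
      volume {w : Fin m → V3 | (∀ i l, |w i l| ≤ 1 / 2) ∧ ∀ i j, i ≠ j → e ≤ ‖w i - w j‖} := by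
  rw [cell_eq_preimage, measure_preimage_add_right]

/-- **Scaling into Ruelle's shrunk cube.** With `e' = e/(1+e)` the homothety of ratio `1 − e' = 1/(1+e)`
maps the centred unit-cube cell set at exclusion `e` into the box set of side `1 − e'` at exclusion `e'`;
hence `(1 − e')^{3m} · vol(cell at e) ≤ vol(box at e')`. -/
theorem scaled_cell_le_box (m : ℕ) {e : ℝ} (he : 0 ≤ e) :
    (1 - e / (1 + e)) ^ (3 * m) *
      (volume {w : Fin m → V3 | (∀ i l, 0 ≤ w i l ∧ w i l ≤ 1) ∧
        ∀ i j, i ≠ j → e ≤ ‖w i - w j‖}).toReal ≤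
      (volume {v : Fin m → V3 | (∀ i l, |v i l| ≤ (1 - e / (1 + e)) / 2) ∧
        ∀ i j, i ≠ j → e / (1 + e) ≤ ‖v i - v j‖}).toReal := by
  set s : ℝ := 1 - e / (1 + e) with hs
  have hs_eq : s = 1 / (1 + e) := by rw [hs]; field_simp; ring
  have hs0 : 0 < s := by rw [hs_eq]; positivity
  have hs1 : s ≤ 1 := by rw [hs_eq, div_le_one (by linarith)]; linarith
  have h2 := FvCubeToTorus.smul_set_subset m (e / (1 + e)) hs0
  have hes : (e / (1 + e)) / s = e := by rw [hs_eq]; field_simp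
  rw [hes] at h2
  have h3 := FvCubeToTorus.volume_smul_set m hs0.le
    {w : Fin m → V3 | (∀ i l, |w i l| ≤ 1 / 2) ∧ ∀ i i', i ≠ i' → e ≤ ‖w i - w i'‖}
  have key : ENNReal.ofReal (s ^ (3 * m)) *
      volume {w : Fin m → V3 | (∀ i l, |w i l| ≤ 1 / 2) ∧ ∀ i i', i ≠ i' → e ≤ ‖w i - w i'‖} ≤
      volume {v : Fin m → V3 | (∀ i l, |v i l| ≤ s / 2) ∧
        ∀ i i', i ≠ i' → e / (1 + e) ≤ ‖v i - v i'‖} := by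
    rw [← h3]; exact measure_mono h2
  have hfin : volume {v : Fin m → V3 | (∀ i l, |v i l| ≤ s / 2) ∧
      ∀ i i', i ≠ i' → e / (1 + e) ≤ ‖v i - v i'‖} ≠ ⊤ :=
    ne_top_of_le_ne_top ENNReal.one_ne_top (tl_mono.2.2 m s (e / (1 + e)) hs0.le hs1)
  have := ENNReal.toReal_mono hfin key
  rw [ENNReal.toReal_mul, ENNReal.toReal_ofReal (by positivity), ← volume_cell_eq] at this
  exact this

/-! ### Elementary real-variable bookkeeping -/

/-- `s^k V ≤ B` with `s t = 1`, `t ≥ 0` gives `V ≤ t^k B`. -/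
theorem le_mul_of_scaled_le {s t V B : ℝ} (k : ℕ) (hst : s * t = 1) (ht : 0 ≤ t)
    (h : s ^ k * V ≤ B) : V ≤ t ^ k * B := by
  have h1 : t ^ k * s ^ k = 1 := by rw [← mul_pow, mul_comm, hst, one_pow]
  calc V = t ^ k * (s ^ k * V) := by rw [← mul_assoc, h1, one_mul]
    _ ≤ t ^ k * B := mul_le_mul_of_nonneg_left h (pow_nonneg ht k)

/-- A rate lower bound `r ≤ −m⁻¹ log B` for `B ≥ 0`, `m > 0` is the volume bound `B ≤ exp(−m r)`. -/
theorem le_exp_of_rate_le {m : ℝ} (hm : 0 < m) {B r : ℝ} (hB0 : 0 ≤ B)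
    (h : r ≤ -m⁻¹ * Real.log B) : B ≤ Real.exp (-(m * r)) := by
  rcases hB0.eq_or_lt with h0 | hpos
  · rw [← h0]; exact (Real.exp_pos _).le
  · have hlog : Real.log B ≤ -(m * r) := by
      have h1 := mul_le_mul_of_nonneg_left h hm.le
      have e1 : m * (-m⁻¹ * Real.log B) = -Real.log B := by field_simp
      linarith
    calc B = Real.exp (Real.log B) := (Real.exp_log hpos).symm
      _ ≤ _ := Real.exp_le_exp.2 hlog

/-- `(1 + e)^{3m} ≤ exp(m ε/3)` as soon as `9e ≤ ε` (`e ≥ 0`). -/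
theorem one_add_pow_le_exp {m : ℕ} {e ε : ℝ} (he : 0 ≤ e) (h : 9 * e ≤ ε) :
    (1 + e) ^ (3 * m) ≤ Real.exp (m * (ε / 3)) := by
  calc (1 + e) ^ (3 * m) ≤ (Real.exp e) ^ (3 * m) :=
        pow_le_pow_left₀ (by linarith) (by linarith [Real.add_one_le_exp e]) _
    _ = Real.exp ((3 * m : ℕ) * e) := (Real.exp_nat_mul e (3 * m)).symm
    _ ≤ Real.exp (m * (ε / 3)) := by
        refine Real.exp_le_exp.2 ?_
        push_cast
        have hm : (0 : ℝ) ≤ m := Nat.cast_nonneg m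
        nlinarith

/-- The shifted density `η' = η/(1+e)³`: for `0 ≤ e ≤ 1`, `0 ≤ η`, one has `η/8 ≤ η' ≤ η` and
`η − η' ≤ 7 η e`. -/
theorem etaShift_bounds {η e : ℝ} (hη : 0 ≤ η) (he0 : 0 ≤ e) (he1 : e ≤ 1) :
    η / 8 ≤ η / (1 + e) ^ 3 ∧ η / (1 + e) ^ 3 ≤ η ∧ η - η / (1 + e) ^ 3 ≤ 7 * η * e := by
  have h1e : (1 : ℝ) ≤ (1 + e) ^ 3 := one_le_pow₀ (by linarith)
  have h1e8 : (1 + e) ^ 3 ≤ 8 := by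
    have : (1 + e) ^ 3 ≤ (2 : ℝ) ^ 3 := pow_le_pow_left₀ (by linarith) (by linarith) 3
    linarith
  have hpos : (0 : ℝ) < (1 + e) ^ 3 := by positivity
  refine ⟨?_, div_le_self hη h1e, ?_⟩
  · rw [div_le_div_iff₀ (by norm_num) hpos]
    nlinarith
  · have h7 : (1 + e) ^ 3 - 1 ≤ 7 * e := by
      nlinarith [mul_nonneg he0 (sub_nonneg.2 he1), mul_nonneg (mul_nonneg he0 he0) (sub_nonneg.2 he1)]
    have hkey : η - η / (1 + e) ^ 3 = η / (1 + e) ^ 3 * ((1 + e) ^ 3 - 1) := by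
      field_simp
    rw [hkey]
    calc η / (1 + e) ^ 3 * ((1 + e) ^ 3 - 1) ≤ η / (1 + e) ^ 3 * (7 * e) :=
          mul_le_mul_of_nonneg_left h7 (by positivity)
      _ ≤ η * (7 * e) := mul_le_mul_of_nonneg_right (div_le_self hη h1e) (by positivity)
      _ = 7 * η * e := by ring

end CellRate

/-- **Uniform cell rate, unshrunk unit cube** (registered stub `stub_cellRate`). [cite: Ruelle1969, §3.4] -/
theorem stub_cellRate : ∀ (a c ε : ℝ), 0 < a → a ≤ c → c < 11 / 10 → 0 < ε → ∀ᶠ m : ℕ in atTop,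
    ∀ η : ℝ, a ≤ η → η ≤ c →
    (volume {w : Fin m → V3 | (∀ i l, 0 ≤ w i l ∧ w i l ≤ 1) ∧
      ∀ i j, i ≠ j → (η / m) ^ (1 / 3 : ℝ) ≤ ‖w i - w j‖}).toReal ≤
      Real.exp (-((m : ℝ) * (hsExcessFreeEnergy η - ε))) := by
  intro a c ε ha hac hc hε
  have hc0 : 0 < c := ha.trans_le hac
  have ha8 : 0 < a / 8 := by positivity
  -- (1) the uniform box rate on the enlarged compact `[a/8, c]` with `ε/3`
  have hE1 := hs_boxRate_uniform (a / 8) c (ε / 3) ha8 (by linarith) hc (by positivity)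
  -- (2) uniform continuity of `f_ex` on `[a/8, c]`
  have hF : ContinuousOn hsExcessFreeEnergy (Icc (a / 8) c) :=
    (Clausius.continuousOn_hsExcessFreeEnergy stub_hsFreeEnergyConvex).mono
      (fun x hx => ⟨ha8.trans_le hx.1, hx.2.trans_lt hc⟩)
  obtain ⟨δ, hδ, hU⟩ := Metric.uniformContinuousOn_iff.1
    (isCompact_Icc.uniformContinuousOn_of_continuous hF) (ε / 3) (by positivity)
  -- (3) the exclusion parameter at the top density tends to zero
  have hte := ThermoLimit.tendsto_e c
  have hE2 : ∀ᶠ m : ℕ in atTop, (c / m) ^ (1 / 3 : ℝ) ≤ ε / 9 := hte.eventually_le_const (by positivity)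
  have hE3 : ∀ᶠ m : ℕ in atTop, (c / m) ^ (1 / 3 : ℝ) < δ / (8 * c) :=
    hte.eventually_lt_const (by positivity)
  filter_upwards [hE1, hE2, hE3, Filter.eventually_ge_atTop 2] with m h1 h2 h3 hm η haη hηc
  have hm0 : (0 : ℝ) < m := by exact_mod_cast (lt_of_lt_of_le (by norm_num) hm)
  have hη0 : 0 < η := ha.trans_le haη
  have hη23 : η ≤ 23 / 20 := by linarith
  obtain ⟨he0, he1⟩ := ThermoLimitA.t_props hm hη0 hη23
  have hec : (η / m) ^ (1 / 3 : ℝ) ≤ (c / m) ^ (1 / 3 : ℝ) := ThermoLimitA.t_mono hη0.le hηc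
  have he3 : ((η / m) ^ (1 / 3 : ℝ)) ^ 3 = η / m :=
    FvMixingParams.rpow_third_pow_three _ (div_nonneg hη0.le hm0.le)
  set e : ℝ := (η / m) ^ (1 / 3 : ℝ) with he
  -- the shifted density
  set η' : ℝ := (m : ℝ) * (e / (1 + e)) ^ 3 with hη'
  have hη'eq : η' = η / (1 + e) ^ 3 := by
    rw [hη', div_pow, he3]; field_simp
  obtain ⟨hη'ge, hη'le, hdiff⟩ := CellRate.etaShift_bounds hη0.le he0.le he1.le
  rw [← hη'eq] at hη'ge hη'le hdiff
  have hη'a : a / 8 ≤ η' := by linarith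
  have hη'c : η' ≤ c := hη'le.trans hηc
  -- (2') `f(η) − ε/3 ≤ f(η')`
  have hdist : dist η η' < δ := by
    rw [Real.dist_eq, abs_of_nonneg (by linarith)]
    have h7 : 7 * η * e ≤ 7 * c * (c / m) ^ (1 / 3 : ℝ) :=
      mul_le_mul (by linarith) hec he0.le (by positivity)
    have h8 : 8 * c * (c / m) ^ (1 / 3 : ℝ) < δ := by
      have := mul_lt_mul_of_pos_left h3 (by positivity : (0 : ℝ) < 8 * c)
      rwa [mul_div_cancel₀ _ (by positivity : (8 : ℝ) * c ≠ 0)] at this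
    have h9 : 0 ≤ c * (c / m) ^ (1 / 3 : ℝ) := by positivity
    linarith
  have hf : hsExcessFreeEnergy η - ε / 3 ≤ hsExcessFreeEnergy η' := by
    have := hU η ⟨by linarith, hηc⟩ η' ⟨hη'a, hη'c⟩ hdist
    rw [Real.dist_eq] at this
    linarith [le_abs_self (hsExcessFreeEnergy η - hsExcessFreeEnergy η')]
  -- (1') the box bound at `η'`, whose exclusion parameter is `e' = e/(1+e)`
  have hthat : (η' / m) ^ (1 / 3 : ℝ) = e / (1 + e) := by
    have hc' : η' / m = (e / (1 + e)) ^ 3 := by rw [hη']; field_simp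
    rw [hc', ← Real.rpow_natCast, ← Real.rpow_mul (by positivity)]
    norm_num
  have hB := h1 η' hη'a hη'c
  rw [hthat] at hB
  have hBexp := CellRate.le_exp_of_rate_le hm0 ENNReal.toReal_nonneg hB
  -- the scaling
  have hscale := CellRate.scaled_cell_le_box m he0.le
  have hst : (1 - e / (1 + e)) * (1 + e) = 1 := by field_simp; ring
  have hV := CellRate.le_mul_of_scaled_le (3 * m) hst (by linarith) hscale
  have hpow : (1 + e) ^ (3 * m) ≤ Real.exp (m * (ε / 3)) :=
    CellRate.one_add_pow_le_exp he0.le (by linarith)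
  -- assemble
  refine hV.trans ?_
  calc (1 + e) ^ (3 * m) * _ ≤ Real.exp (m * (ε / 3)) *
        Real.exp (-(m * (hsExcessFreeEnergy η' - ε / 3))) :=
        mul_le_mul hpow hBexp ENNReal.toReal_nonneg (Real.exp_pos _).le
    _ = Real.exp (m * (ε / 3) + -(m * (hsExcessFreeEnergy η' - ε / 3))) := (Real.exp_add _ _).symm
    _ ≤ Real.exp (-(m * (hsExcessFreeEnergy η - ε))) := by
        refine Real.exp_le_exp.2 ?_
        have := mul_le_mul_of_nonneg_left hf hm0.le
        nlinarith

end Barycentric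

end Summit.AtomisticToContinuum.HydrodynamicLimit.Theorems.MacroClosureLine

end
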